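import Literature.Analysis.FunctionSpaces.PolchinskiFluctuationHeat
import Literature.Analysis.FunctionSpaces.PolchinskiRenormDensity
import Literature.Analysis.FunctionSpaces.PolchinskiSmoothing
import HarnessLib

/-!
# The dual generator identity `−∂_t E_{ν_t}[F] = E_{ν_t}[L_t F]`
# (Bauerschmidt–Bodineau–Dagallier, Proposition 8, second identity of (e:polchinski-semigroup))

Topic `Literature/Analysis/FunctionSpaces`; eighth "proof architecture" file behind the named fact
`Polchinski.BauerschmidtBodineau_multiscaleBakryEmery` ([BBD] Theorem 3, `MultiscaleBakryEmery.lean`).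
[BBD] Proposition 8 (p0014 L106–113): «the measures `ν_t` evolve dual to `(P_{s,t})` in the sense that
`E_{ν_t}[P_{s,t}F] = E_{ν_s}[F]` and `−∂_t E_{ν_t}[F] = E_{ν_t}[L_tF]`», `L_tF = ½Δ_{Ċ_t}F − (∇V_t,∇F)_{Ċ_t}`.
The first identity is `renormExpect_semigroup` (`PolchinskiSemigroup.lean`); this file proves the second,
for `t > 0` and `F ∈ C_b²` (bounded, with bounded first and bounded uniformly continuous second
derivative).  Since `E_{ν_t}[F] = e^{V_∞(0)} E_{C_∞−C_t}[Z_t F]` with `Z_t = e^{−V_t}` ([BBD] Def 2), the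
derivative has a covariance part (backward heat equation of `C_∞ − C_t`, `PolchinskiFluctuationHeat.lean`,
applied to the fixed integrand `Z_tF`) and an integrand part (`∂_tZ_t = ½Δ_{Ċ_t}Z_t` under the outer
average, `PolchinskiRenormDensity.lean`); the two are joined through the uniform-in-space
differentiability of `t ↦ Z_t(y)` (from the two-scale bounds of `PolchinskiHeatEquation.lean`), and the
terms `F Δ_{Ċ_t}Z_t` cancel, leaving `−E_{C_∞−C_t}[Z_t(½Δ_{Ċ_t}F − (∇V_t,∇F)_{Ċ_t})]` because
`∇Z_t = −Z_t∇V_t` — [BBD]'s «`−∂_tν_t = L_t^*ν_t`» (p0014 L116–120).  ([BBD] derive the identity by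
differentiating the first one in `s`; the direct computation here is the same bookkeeping.)

## Main results (sorry-free; no new definitions, no new named facts)

* `hasDerivAt_integral_renormDensity_mul` — the joint derivative
  `d/dt E_{C_∞−C_t}[e^{−V_t}F(φ+·)] = −½ΣĊ_t^{ij}E_{C_∞−C_t}[∂_i∂_j(Z_tF)(φ+·)] + E_{C_∞−C_t}[(∂_tZ_t)F(φ+·)]`.
* **`hasDerivAt_renormExpect`** — **[BBD] Prop 8, dual identity**: for `t > 0`,
  `d/dt E_{ν_t}[F] = −E_{ν_t}[L_tF]`, `L_tF(y) = ½Σ_{ij}Ċ_t^{ij}∂_i∂_jF(y) − Σ_{ij}Ċ_t^{ij}∂_iV_t(y)∂_jF(y)`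
  with `∇V_t = −∇Z_t/Z_t` the derivative certified by `hasFDerivAt_renormPotential`.

Hypotheses: `D : Polchinski.CovDecomposition N` (possibly degenerate `Ċ_t`); `V₀` bounded below with
`e^{−V₀}` twice Fréchet differentiable, `∇e^{−V₀}` bounded, `D²e^{−V₀}` bounded and uniformly continuous;
`F` bounded, twice Fréchet differentiable, `∇F` bounded, `D²F` bounded and uniformly continuous.
-- TODO(general form): `t`-dependent test functions (`−d/dt E_{ν_t}[G_t] = E_{ν_t}[L_tG_t − ∂_tG_t]`, the
-- form used in (e:dEnt)); the right derivative at `t = 0`.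
Nothing here concerns Yang–Mills.

## References

* [BauerschmidtBodineauDagallier2023] R. Bauerschmidt, T. Bodineau, B. Dagallier, Probab. Surveys 21
  (2024) 200–290, arXiv:2307.07619 — Prop 8 p0014 L77–120, proof p0015 L1–45. READ (held).
* [BauerschmidtBodineau2021SineGordonLSI] R. Bauerschmidt, T. Bodineau, CPAM 74 (2021), §2. READ (held).
-/

noncomputable section

-- nested operator-norm instances `E →L[ℝ] E →L[ℝ] ℝ`
set_option maxSynthPendingDepth 2

open MeasureTheory ProbabilityTheory Filter Topology Set Asymptotics
open scoped RealInnerProductSpace Matrix MatrixOrder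

namespace Literature.Analysis.FunctionSpaces

namespace Polchinski

variable {N : ℕ}

section Helpers

/-- Uniform continuity from a bounded Fréchet derivative. [folklore] -/
private theorem uc_of_fderiv_bound {Y : Type*} [NormedAddCommGroup Y] [NormedSpace ℝ Y]
    {H : EuclideanSpace ℝ (Fin N) → Y} {DH : EuclideanSpace ℝ (Fin N) → EuclideanSpace ℝ (Fin N) →L[ℝ] Y}
    (h1 : ∀ x, HasFDerivAt H (DH x) x) {K : ℝ} (hK : ∀ x, ‖DH x‖ ≤ K) : UniformContinuous H := by
  have hK0 : 0 ≤ K := le_trans (norm_nonneg _) (hK 0)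
  have hlip : ∀ a b : EuclideanSpace ℝ (Fin N), ‖H a - H b‖ ≤ K * ‖a - b‖ := fun a b =>
    Convex.norm_image_sub_le_of_norm_hasFDerivWithin_le (𝕜 := ℝ) (s := univ)
      (fun x _ => (h1 x).hasFDerivWithinAt) (fun x _ => hK x) convex_univ (mem_univ b) (mem_univ a)
  rw [Metric.uniformContinuous_iff]
  intro ε hε
  refine ⟨ε / (K + 1), by positivity, fun {a b} hab => ?_⟩
  rw [dist_eq_norm] at hab ⊢
  calc ‖H a - H b‖ ≤ K * ‖a - b‖ := hlip a b
    _ ≤ K * (ε / (K + 1)) := mul_le_mul_of_nonneg_left hab.le hK0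
    _ < ε := by
      rw [mul_div_assoc']
      rw [div_lt_iff₀ (by positivity)]
      nlinarith

/-- The product of a bounded uniformly continuous scalar function and a bounded uniformly continuous
vector-valued function is uniformly continuous. [folklore] -/
private theorem uc_smul {Y : Type*} [NormedAddCommGroup Y] [NormedSpace ℝ Y]
    {a : EuclideanSpace ℝ (Fin N) → ℝ} {b : EuclideanSpace ℝ (Fin N) → Y}
    (ha : UniformContinuous a) (hb : UniformContinuous b) {A : ℝ} (hA : ∀ x, |a x| ≤ A)
    {B : ℝ} (hB : ∀ x, ‖b x‖ ≤ B) : UniformContinuous fun x => a x • b x := by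
  have hA0 : 0 ≤ A := le_trans (abs_nonneg _) (hA 0)
  have hB0 : 0 ≤ B := le_trans (norm_nonneg _) (hB 0)
  rw [Metric.uniformContinuous_iff]
  intro ε hε
  obtain ⟨δa, hδa, ha'⟩ := Metric.uniformContinuous_iff.mp ha (ε / (2 * (B + 1))) (by positivity)
  obtain ⟨δb, hδb, hb'⟩ := Metric.uniformContinuous_iff.mp hb (ε / (2 * (A + 1))) (by positivity)
  refine ⟨min δa δb, lt_min hδa hδb, fun {x y} hxy => ?_⟩
  have hxa : dist x y < δa := lt_of_lt_of_le hxy (min_le_left _ _)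
  have hxb : dist x y < δb := lt_of_lt_of_le hxy (min_le_right _ _)
  have h1 := ha' hxa
  have h2 := hb' hxb
  rw [dist_eq_norm] at h1 h2 ⊢
  have hsplit : a x • b x - a y • b y = a x • (b x - b y) + (a x - a y) • b y := by
    rw [smul_sub, sub_smul]; abel
  rw [hsplit]
  calc ‖a x • (b x - b y) + (a x - a y) • b y‖
      ≤ ‖a x • (b x - b y)‖ + ‖(a x - a y) • b y‖ := norm_add_le _ _
    _ = |a x| * ‖b x - b y‖ + |a x - a y| * ‖b y‖ := by
        rw [norm_smul, norm_smul, Real.norm_eq_abs, Real.norm_eq_abs]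
    _ ≤ A * (ε / (2 * (A + 1))) + (ε / (2 * (B + 1))) * B := by
        have h1' : |a x - a y| ≤ ε / (2 * (B + 1)) := by rw [← Real.norm_eq_abs]; exact h1.le
        exact add_le_add (mul_le_mul (hA x) h2.le (norm_nonneg _) hA0)
          (mul_le_mul h1' (hB y) (norm_nonneg _) (by positivity))
    _ < ε := by
        have h3 : A * (ε / (2 * (A + 1))) < ε / 2 := by
          rw [mul_div_assoc', div_lt_div_iff₀ (by positivity) (by positivity)]; nlinarith
        have h4 : (ε / (2 * (B + 1))) * B < ε / 2 := by
          rw [div_mul_eq_mul_div, div_lt_div_iff₀ (by positivity) (by positivity)]; nlinarith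
        linarith

/-- `x ↦ c(x) ⊗ d(x)` (`smulRight`) is uniformly continuous for bounded uniformly continuous covector
fields `c`, `d`. [folklore] -/
private theorem uc_smulRight
    {c d : EuclideanSpace ℝ (Fin N) → EuclideanSpace ℝ (Fin N) →L[ℝ] ℝ}
    (hc : UniformContinuous c) (hd : UniformContinuous d) {Cc : ℝ} (hCc : ∀ x, ‖c x‖ ≤ Cc)
    {Cd : ℝ} (hCd : ∀ x, ‖d x‖ ≤ Cd) :
    UniformContinuous fun x => (c x).smulRight (d x) := by
  have hC0 : 0 ≤ Cc := le_trans (norm_nonneg _) (hCc 0)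
  have hD0 : 0 ≤ Cd := le_trans (norm_nonneg _) (hCd 0)
  rw [Metric.uniformContinuous_iff]
  intro ε hε
  obtain ⟨δc, hδc, hc'⟩ := Metric.uniformContinuous_iff.mp hc (ε / (2 * (Cd + 1))) (by positivity)
  obtain ⟨δd, hδd, hd'⟩ := Metric.uniformContinuous_iff.mp hd (ε / (2 * (Cc + 1))) (by positivity)
  refine ⟨min δc δd, lt_min hδc hδd, fun {x y} hxy => ?_⟩
  have h1 := hc' (lt_of_lt_of_le hxy (min_le_left _ _))
  have h2 := hd' (lt_of_lt_of_le hxy (min_le_right _ _))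
  rw [dist_eq_norm] at h1 h2 ⊢
  have hsplit : (c x).smulRight (d x) - (c y).smulRight (d y) =
      (c x - c y).smulRight (d x) + (c y).smulRight (d x - d y) := by
    refine ContinuousLinearMap.ext fun v => ContinuousLinearMap.ext fun w => ?_
    simp only [_root_.sub_apply, _root_.add_apply, ContinuousLinearMap.smulRight_apply,
      _root_.smul_apply, smul_eq_mul]
    ring
  rw [hsplit]
  calc ‖(c x - c y).smulRight (d x) + (c y).smulRight (d x - d y)‖
      ≤ ‖(c x - c y).smulRight (d x)‖ + ‖(c y).smulRight (d x - d y)‖ := norm_add_le _ _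
    _ = ‖c x - c y‖ * ‖d x‖ + ‖c y‖ * ‖d x - d y‖ := by
        rw [ContinuousLinearMap.norm_smulRight_apply, ContinuousLinearMap.norm_smulRight_apply]
    _ ≤ (ε / (2 * (Cd + 1))) * Cd + Cc * (ε / (2 * (Cc + 1))) :=
        add_le_add (mul_le_mul h1.le (hCd x) (norm_nonneg _) (by positivity))
          (mul_le_mul (hCc y) h2.le (norm_nonneg _) hC0)
    _ < ε := by
        have h3 : (ε / (2 * (Cd + 1))) * Cd < ε / 2 := by
          rw [div_mul_eq_mul_div, div_lt_div_iff₀ (by positivity) (by positivity)]; nlinarith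
        have h4 : Cc * (ε / (2 * (Cc + 1))) < ε / 2 := by
          rw [mul_div_assoc', div_lt_div_iff₀ (by positivity) (by positivity)]; nlinarith
        linarith

/-- Matrix elements of a bounded uniformly continuous Hessian: measurable, bounded, uniformly
continuous (scalar functions). [folklore] -/
private theorem eval₂_facts {D2 : EuclideanSpace ℝ (Fin N) →
      EuclideanSpace ℝ (Fin N) →L[ℝ] EuclideanSpace ℝ (Fin N) →L[ℝ] ℝ}
    {M : ℝ} (hM : ∀ x, ‖D2 x‖ ≤ M) (hUC : UniformContinuous D2) (i j : Fin N) :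
    Continuous (fun x => D2 x (EuclideanSpace.single i 1) (EuclideanSpace.single j 1)) ∧
    (∀ x, |D2 x (EuclideanSpace.single i 1) (EuclideanSpace.single j 1)| ≤ M) ∧
    UniformContinuous (fun x => D2 x (EuclideanSpace.single i 1) (EuclideanSpace.single j 1)) := by
  have hev : UniformContinuous fun L : EuclideanSpace ℝ (Fin N) →L[ℝ] EuclideanSpace ℝ (Fin N) →L[ℝ] ℝ =>
      L (EuclideanSpace.single i 1) (EuclideanSpace.single j 1) :=
    (ContinuousLinearMap.apply ℝ ℝ (EuclideanSpace.single j (1:ℝ))).uniformContinuous.comp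
      (ContinuousLinearMap.apply ℝ (EuclideanSpace ℝ (Fin N) →L[ℝ] ℝ)
        (EuclideanSpace.single i (1:ℝ))).uniformContinuous
  refine ⟨(hev.comp hUC).continuous, fun x => ?_, hev.comp hUC⟩
  rw [← Real.norm_eq_abs]
  calc ‖D2 x (EuclideanSpace.single i 1) (EuclideanSpace.single j 1)‖
      ≤ ‖D2 x (EuclideanSpace.single i 1)‖ * ‖EuclideanSpace.single j (1:ℝ)‖ :=
        ContinuousLinearMap.le_opNorm _ _
    _ ≤ ‖D2 x‖ * ‖EuclideanSpace.single i (1:ℝ)‖ * ‖EuclideanSpace.single j (1:ℝ)‖ :=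
        mul_le_mul_of_nonneg_right (ContinuousLinearMap.le_opNorm _ _) (norm_nonneg _)
    _ = ‖D2 x‖ := by simp
    _ ≤ M := hM x

/-- `|∫ f| ≤ C` on a probability space when `|f| ≤ C` pointwise. [folklore] -/
private theorem abs_integral_le_of_abs_le {f : EuclideanSpace ℝ (Fin N) → ℝ} {C : ℝ}
    (P : Measure (EuclideanSpace ℝ (Fin N))) [IsProbabilityMeasure P] (hf : ∀ x, |f x| ≤ C) :
    |∫ x, f x ∂P| ≤ C := by
  have h := norm_integral_le_of_norm_le_const (μ := P) (f := f) (C := C)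
    (Eventually.of_forall fun x => by rw [Real.norm_eq_abs]; exact hf x)
  rwa [Real.norm_eq_abs, probReal_univ, mul_one] at h

/-- Finite sums of uniformly continuous real functions are uniformly continuous. [folklore] -/
private theorem uc_finset_sum {ι : Type*} [DecidableEq ι] (S : Finset ι)
    (f : ι → EuclideanSpace ℝ (Fin N) → ℝ) (h : ∀ i ∈ S, UniformContinuous (f i)) :
    UniformContinuous fun x => ∑ i ∈ S, f i x := by
  induction S using Finset.induction_on with
  | empty => simpa using uniformContinuous_const
  | @insert a S ha ih =>
    have hfun : (fun x => ∑ i ∈ insert a S, f i x) = fun x => f a x + ∑ i ∈ S, f i x :=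
      funext fun x => Finset.sum_insert ha
    rw [hfun]
    exact (h a (Finset.mem_insert_self a S)).add
      (ih fun i hi => h i (Finset.mem_insert_of_mem hi))

end Helpers

section Dual

variable (D : CovDecomposition N) {V₀ : EuclideanSpace ℝ (Fin N) → ℝ}
  {D1 : EuclideanSpace ℝ (Fin N) → EuclideanSpace ℝ (Fin N) →L[ℝ] ℝ}
  {D2 : EuclideanSpace ℝ (Fin N) → EuclideanSpace ℝ (Fin N) →L[ℝ] EuclideanSpace ℝ (Fin N) →L[ℝ] ℝ}
  {F : EuclideanSpace ℝ (Fin N) → ℝ}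
  {DF : EuclideanSpace ℝ (Fin N) → EuclideanSpace ℝ (Fin N) →L[ℝ] ℝ}
  {D2F : EuclideanSpace ℝ (Fin N) → EuclideanSpace ℝ (Fin N) →L[ℝ] EuclideanSpace ℝ (Fin N) →L[ℝ] ℝ}

-- one long ε-bookkeeping proof (two cases, five error terms); the budget is for its many small steps
set_option maxHeartbeats 800000 in
/-- **Uniform-in-space differentiability of `t ↦ Z_t(y) = E_{C_t}[e^{−V₀(y+w)}]`**: for `t > 0` and every
`ε > 0`, eventually (as `s → t`) `|Z_s(y) − Z_t(y) − (s−t)·½ΣĊ_t^{ij}E_{C_t}[∂_i∂_je^{−V₀}(y+w)]| ≤ ε|s−t|`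
for ALL `y` simultaneously (the two-scale bounds of Prop 5 are uniform in the base point).
[cite: BauerschmidtBodineauDagallier2023, Proposition 5 (proof)] -/
theorem eventually_abs_integral_exp_neg_sub_sub_mul_le
    (hG1 : ∀ x, HasFDerivAt (fun x => Real.exp (-V₀ x)) (D1 x) x)
    (hG2 : ∀ x, HasFDerivAt D1 (D2 x) x) {b : ℝ} (hb : ∀ φ, b ≤ V₀ φ)
    {M : ℝ} (hM : ∀ x, ‖D2 x‖ ≤ M) (hUC : UniformContinuous D2)
    {t : ℝ} (ht : 0 < t) {ε : ℝ} (hε : 0 < ε) :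
    ∀ᶠ s in 𝓝 t, ∀ y : EuclideanSpace ℝ (Fin N),
      |(∫ ζ, Real.exp (-V₀ (y + ζ)) ∂(multivariateGaussian 0 (D.C s))) -
          (∫ ζ, Real.exp (-V₀ (y + ζ)) ∂(multivariateGaussian 0 (D.C t))) -
          (s - t) * ((1 / 2) * ∑ i, ∑ j, D.Cdot t i j *
            ∫ w, D2 (y + w) (EuclideanSpace.single i 1) (EuclideanSpace.single j 1)
              ∂(multivariateGaussian 0 (D.C t)))| ≤ ε * |s - t| := by
  have hD2m : Measurable D2 := hUC.continuous.measurable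
  have hGb : ∀ x, |Real.exp (-V₀ x)| ≤ Real.exp (-b) := fun x => by
    rw [abs_of_pos (Real.exp_pos _)]
    exact Real.exp_le_exp.2 (neg_le_neg (hb x))
  have hM0 : 0 ≤ M := le_trans (norm_nonneg _) (hM 0)
  set K4 : ℝ := ∫ z, ‖z‖ ^ 4 ∂(stdGaussian (EuclideanSpace ℝ (Fin N))) with hK4
  have hK40 : 0 ≤ K4 := integral_nonneg fun z => by positivity
  -- the Hessian averages at scale `t` and their bound
  have hI : ∀ (r : ℝ) (i j : Fin N) (y : EuclideanSpace ℝ (Fin N)),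
      |∫ w, D2 (y + w) (EuclideanSpace.single i 1) (EuclideanSpace.single j 1)
        ∂(multivariateGaussian 0 (D.C r))| ≤ M := by
    intro r i j y
    obtain ⟨-, hb2, -⟩ := eval₂_facts hM hUC i j
    exact abs_integral_le_of_abs_le _ fun w => hb2 (y + w)
  -- scales
  set T : ℝ := ∑ i, (|D.Cdot t i i| + 1) + 1 with hT
  set T2 : ℝ := ∑ i, ∑ j, (|D.Cdot t i j| + 1) + 1 with hT2
  have hT0 : 0 < T := by positivity
  have hT20 : 0 < T2 := by positivity
  set CN : ℝ := ∑ _i : Fin N, ∑ _j : Fin N, (1:ℝ) with hCN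
  have hCN0 : 0 ≤ CN := by positivity
  -- small parameters
  set ε₁ : ℝ := ε / (4 * T) with hε₁
  have hε₁0 : 0 < ε₁ := by positivity
  obtain ⟨δ, hδ, hUCδ⟩ : ∃ δ > 0, ∀ x y : EuclideanSpace ℝ (Fin N), ‖x - y‖ < δ → ‖D2 x - D2 y‖ ≤ ε₁ := by
    obtain ⟨δ, hδ, h⟩ := Metric.uniformContinuous_iff.mp hUC ε₁ hε₁0
    refine ⟨δ, hδ, fun x y hxy => ?_⟩
    have h' := h (a := x) (b := y) (by rwa [dist_eq_norm])
    rw [dist_eq_norm] at h'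
    exact h'.le
  set ε₂ : ℝ := min 1 (ε / (4 * (M * CN + 1))) with hε₂
  have hε₂0 : 0 < ε₂ := lt_min one_pos (by positivity)
  have hε₂1 : ε₂ ≤ 1 := min_le_left _ _
  have hε₂2 : ε₂ ≤ ε / (4 * (M * CN + 1)) := min_le_right _ _
  set ε₃ : ℝ := ε / (4 * T2) with hε₃
  have hε₃0 : 0 < ε₃ := by positivity
  obtain ⟨δ₃, hδ₃, hUCδ₃⟩ : ∃ δ₃ > 0, ∀ i j, ∀ x y : EuclideanSpace ℝ (Fin N), ‖x - y‖ < δ₃ →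
      |D2 x (EuclideanSpace.single i 1) (EuclideanSpace.single j 1) -
        D2 y (EuclideanSpace.single i 1) (EuclideanSpace.single j 1)| ≤ ε₃ / 2 := by
    obtain ⟨δ₃, hδ₃, h⟩ := Metric.uniformContinuous_iff.mp hUC (ε₃ / 2) (half_pos hε₃0)
    refine ⟨δ₃, hδ₃, fun i j x y hxy => ?_⟩
    have h' := (h (a := x) (b := y) (by rwa [dist_eq_norm])).le
    rw [dist_eq_norm] at h'
    rw [← _root_.sub_apply, ← _root_.sub_apply, ← Real.norm_eq_abs]
    calc ‖(D2 x - D2 y) (EuclideanSpace.single i 1) (EuclideanSpace.single j 1)‖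
        ≤ ‖(D2 x - D2 y) (EuclideanSpace.single i 1)‖ * ‖EuclideanSpace.single j (1:ℝ)‖ :=
          ContinuousLinearMap.le_opNorm _ _
      _ ≤ ‖D2 x - D2 y‖ * ‖EuclideanSpace.single i (1:ℝ)‖ * ‖EuclideanSpace.single j (1:ℝ)‖ :=
          mul_le_mul_of_nonneg_right (ContinuousLinearMap.le_opNorm _ _) (norm_nonneg _)
      _ = ‖D2 x - D2 y‖ := by simp
      _ ≤ ε₃ / 2 := h'
  -- eventual facts as `s → t`
  have evA : ∀ᶠ s in 𝓝 t, ∀ i j, |D.C s i j - D.C t i j - (s - t) * D.Cdot t i j| ≤ ε₂ * |s - t| := by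
    have h : ∀ i j, ∀ᶠ s in 𝓝 t, |D.C s i j - D.C t i j - (s - t) * D.Cdot t i j| ≤ ε₂ * |s - t| := by
      intro i j
      have hl := ((D.hasDerivAt_C t ht.le i j).isLittleO).def hε₂0
      filter_upwards [hl] with s hs
      simpa [Real.norm_eq_abs, smul_eq_mul] using hs
    exact eventually_all.2 fun i => eventually_all.2 fun j => h i j
  have evC : ∀ᶠ s in 𝓝 t, 0 < s := isOpen_Ioi.mem_nhds ht
  have evD : ∀ᶠ s in 𝓝 t, |s - t| < ε / (4 * (2 * M / δ ^ 2 * K4 * T2 ^ 2 + 1)) := by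
    have h0 : Tendsto (fun s : ℝ => s - t) (𝓝 t) (𝓝 (t - t)) := tendsto_id.sub_const t
    rw [sub_self] at h0
    have h := h0.abs
    rw [abs_zero] at h
    exact (tendsto_order.1 h).2 _ (by positivity)
  have evE : ∀ᶠ s in 𝓝 t, 2 * M / δ₃ ^ 2 * |∑ i, (D.C t i i - D.C s i i)| < ε₃ / 2 := by
    have h0 : ∀ i, Tendsto (fun s => D.C t i i - D.C s i i) (𝓝 t) (𝓝 0) := by
      intro i
      have h := (D.hasDerivAt_C t ht.le i i).continuousAt.tendsto.const_sub (D.C t i i)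
      rw [sub_self] at h
      exact h
    have h := ((tendsto_finsetSum (Finset.univ : Finset (Fin N)) fun i _ => h0 i).abs).const_mul
      (2 * M / δ₃ ^ 2)
    simp only [Finset.sum_const_zero, abs_zero, mul_zero] at h
    exact (tendsto_order.1 h).2 _ (half_pos hε₃0)
  filter_upwards [evA, evC, evD, evE] with s hsA hs0 hsD hsE y
  -- abbreviations
  set a : ℝ := |s - t| with ha
  have ha0 : 0 ≤ a := abs_nonneg _
  have hSij : ∀ i j, |D.C s i j - D.C t i j| ≤ a * (|D.Cdot t i j| + 1) := by
    intro i j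
    have h1 := hsA i j
    calc |D.C s i j - D.C t i j|
        = |(D.C s i j - D.C t i j - (s - t) * D.Cdot t i j) + (s - t) * D.Cdot t i j| := by ring_nf
      _ ≤ |D.C s i j - D.C t i j - (s - t) * D.Cdot t i j| + |(s - t) * D.Cdot t i j| :=
          abs_add_le _ _
      _ ≤ ε₂ * a + a * |D.Cdot t i j| := by rw [abs_mul]; gcongr
      _ ≤ 1 * a + a * |D.Cdot t i j| := by gcongr
      _ = a * (|D.Cdot t i j| + 1) := by ring
  -- trace and ℓ¹ bounds for `C_s − C_t` (either orientation)
  have htr : ∀ (S : Matrix (Fin N) (Fin N) ℝ), (∀ i j, |S i j| = |D.C s i j - D.C t i j|) →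
      ∑ i, S i i ≤ a * T ∧ ∑ i, ∑ j, |S i j| ≤ a * T2 := by
    intro S hS
    constructor
    · calc ∑ i, S i i ≤ ∑ i, |S i i| := Finset.sum_le_sum fun i _ => le_abs_self _
        _ ≤ ∑ i, a * (|D.Cdot t i i| + 1) := Finset.sum_le_sum fun i _ => by rw [hS]; exact hSij i i
        _ = a * ∑ i, (|D.Cdot t i i| + 1) := by rw [Finset.mul_sum]
        _ ≤ a * T := by
            apply mul_le_mul_of_nonneg_left _ ha0
            rw [hT]; linarith only
    · calc ∑ i, ∑ j, |S i j| ≤ ∑ i, ∑ j, a * (|D.Cdot t i j| + 1) :=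
            Finset.sum_le_sum fun i _ => Finset.sum_le_sum fun j _ => by rw [hS]; exact hSij i j
        _ = a * ∑ i, ∑ j, (|D.Cdot t i j| + 1) := by
            rw [Finset.mul_sum]
            exact Finset.sum_congr rfl fun i _ => by rw [Finset.mul_sum]
        _ ≤ a * T2 := by
            apply mul_le_mul_of_nonneg_left _ ha0
            rw [hT2]; linarith only
  -- the Taylor remainder of the quadratic term: |½ΣΣ (S_ij − (s−t)Ċ_ij) I_ij| ≤ ½ ε₂ a M CN
  have hquadR : ∀ (I : Fin N → Fin N → ℝ), (∀ i j, |I i j| ≤ M) →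
      |(1 / 2) * ∑ i, ∑ j, (D.C s i j - D.C t i j) * I i j -
        (s - t) * ((1 / 2) * ∑ i, ∑ j, D.Cdot t i j * I i j)| ≤ (1 / 2) * (ε₂ * a * (M * CN)) := by
    intro I hIb
    have hre : (1 / 2) * ∑ i, ∑ j, (D.C s i j - D.C t i j) * I i j -
        (s - t) * ((1 / 2) * ∑ i, ∑ j, D.Cdot t i j * I i j) =
        (1 / 2) * ∑ i, ∑ j, (D.C s i j - D.C t i j - (s - t) * D.Cdot t i j) * I i j := by
      have h1 : ∀ i j, (D.C s i j - D.C t i j - (s - t) * D.Cdot t i j) * I i j =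
          (D.C s i j - D.C t i j) * I i j - (s - t) * (D.Cdot t i j * I i j) := fun i j => by ring
      simp only [h1, Finset.sum_sub_distrib, ← Finset.mul_sum]
      ring
    rw [hre, abs_mul, abs_of_pos (by norm_num : (0:ℝ) < 1 / 2)]
    refine mul_le_mul_of_nonneg_left ?_ (by norm_num)
    calc |∑ i, ∑ j, (D.C s i j - D.C t i j - (s - t) * D.Cdot t i j) * I i j|
        ≤ ∑ i, ∑ j, ε₂ * a * M := by
          refine (Finset.abs_sum_le_sum_abs _ _).trans (Finset.sum_le_sum fun i _ => ?_)
          refine (Finset.abs_sum_le_sum_abs _ _).trans (Finset.sum_le_sum fun j _ => ?_)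
          rw [abs_mul]
          exact mul_le_mul (hsA i j) (hIb i j) (abs_nonneg _) (by positivity)
      _ = ε₂ * a * (M * CN) := by
          rw [hCN]
          simp only [Finset.sum_const, Finset.card_univ, nsmul_eq_mul]
          ring
  -- numeric sizes of the three error terms
  have hN1 : ε₁ * (a * T) = ε / 4 * a := by
    rw [hε₁]; field_simp
  have hN2 : 2 * M / δ ^ 2 * ((a * T2) ^ 2 * K4) ≤ ε / 4 * a := by
    have hc0 : 0 ≤ 2 * M / δ ^ 2 * K4 * T2 ^ 2 := by positivity
    have h1 : 2 * M / δ ^ 2 * K4 * T2 ^ 2 * a ≤ (2 * M / δ ^ 2 * K4 * T2 ^ 2 + 1) * a := by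
      have : 0 ≤ 1 * a := by positivity
      linarith only [this]
    have h2 : (2 * M / δ ^ 2 * K4 * T2 ^ 2 + 1) * a ≤
        (2 * M / δ ^ 2 * K4 * T2 ^ 2 + 1) * (ε / (4 * (2 * M / δ ^ 2 * K4 * T2 ^ 2 + 1))) :=
      mul_le_mul_of_nonneg_left hsD.le (by positivity)
    have h3 : (2 * M / δ ^ 2 * K4 * T2 ^ 2 + 1) * (ε / (4 * (2 * M / δ ^ 2 * K4 * T2 ^ 2 + 1))) =
        ε / 4 := by
      field_simp
    calc 2 * M / δ ^ 2 * ((a * T2) ^ 2 * K4) = (2 * M / δ ^ 2 * K4 * T2 ^ 2 * a) * a := by ring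
      _ ≤ ε / 4 * a := mul_le_mul_of_nonneg_right (by linarith only [h1, h2, h3]) ha0
  have hN3 : (1 / 2) * (ε₂ * a * (M * CN)) ≤ ε / 4 * a := by
    have h1 : ε₂ * (M * CN) ≤ ε / 4 := by
      calc ε₂ * (M * CN) ≤ ε / (4 * (M * CN + 1)) * (M * CN + 1) :=
            mul_le_mul hε₂2 (by linarith) (by positivity) (by positivity)
        _ = ε / 4 := by field_simp
    calc (1 / 2) * (ε₂ * a * (M * CN)) = (1 / 2) * a * (ε₂ * (M * CN)) := by ring
      _ ≤ (1 / 2) * a * (ε / 4) := mul_le_mul_of_nonneg_left h1 (by positivity)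
      _ ≤ ε / 4 * a := by linarith only [mul_nonneg hε.le ha0]
  -- names for the scalar quantities at `y`
  set Zs : ℝ := ∫ ζ, Real.exp (-V₀ (y + ζ)) ∂(multivariateGaussian 0 (D.C s)) with hZs
  set Zt : ℝ := ∫ ζ, Real.exp (-V₀ (y + ζ)) ∂(multivariateGaussian 0 (D.C t)) with hZt
  set Q : ℝ := (s - t) * ((1 / 2) * ∑ i, ∑ j, D.Cdot t i j *
    ∫ w, D2 (y + w) (EuclideanSpace.single i 1) (EuclideanSpace.single j 1)
      ∂(multivariateGaussian 0 (D.C t))) with hQ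
  set P3 : ℝ := (1 / 2) * ∑ i, ∑ j, (D.C s i j - D.C t i j) *
    ∫ w, D2 (y + w) (EuclideanSpace.single i 1) (EuclideanSpace.single j 1)
      ∂(multivariateGaussian 0 (D.C t)) with hP3
  have hQ3 : |P3 - Q| ≤ ε / 4 * a :=
    (hquadR (fun i j => ∫ w, D2 (y + w) (EuclideanSpace.single i 1)
      (EuclideanSpace.single j 1) ∂(multivariateGaussian 0 (D.C t))) (fun i j => hI t i j y)).trans hN3
  rcases le_or_gt t s with hts | hst
  · -- Case `t ≤ s`: expansion based at `C_t`
    have hE := abs_integral_C_sub_integral_C_sub_sum_le D hG1 hG2 hD2m hGb hM hδ hUCδ ht.le hts y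
    obtain ⟨htr1, hl1⟩ := htr (D.C s - D.C t) (fun i j => by simp [Matrix.sub_apply])
    have hP3' : (1 / 2) * ∑ i, ∑ j, (D.C s - D.C t) i j *
        ∫ w, D2 (y + w) (EuclideanSpace.single i 1) (EuclideanSpace.single j 1)
          ∂(multivariateGaussian 0 (D.C t)) = P3 := by
      simp only [Matrix.sub_apply, hP3]
    rw [hP3'] at hE
    have hE' : |Zs - Zt - P3| ≤ ε / 4 * a + ε / 4 * a := by
      rw [← hK4, ← hZs, ← hZt] at hE
      refine hE.trans ?_
      have h8 : (∑ i, ∑ j, |(D.C s - D.C t) i j|) ^ 2 ≤ (a * T2) ^ 2 :=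
        pow_le_pow_left₀ (Finset.sum_nonneg fun i _ => Finset.sum_nonneg fun j _ =>
          abs_nonneg _) hl1 2
      have h9 : ε₁ * ∑ i, (D.C s - D.C t) i i ≤ ε₁ * (a * T) :=
        mul_le_mul_of_nonneg_left htr1 hε₁0.le
      have h10 : 2 * M / δ ^ 2 * ((∑ i, ∑ j, |(D.C s - D.C t) i j|) ^ 2 * K4) ≤
          2 * M / δ ^ 2 * ((a * T2) ^ 2 * K4) :=
        mul_le_mul_of_nonneg_left (mul_le_mul_of_nonneg_right h8 hK40) (by positivity)
      linarith only [h9, h10, hN1, hN2]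
    calc |Zs - Zt - Q| ≤ |Zs - Zt - P3| + |P3 - Q| := abs_sub_le (Zs - Zt) P3 Q
      _ ≤ (ε / 4 * a + ε / 4 * a) + ε / 4 * a := add_le_add hE' hQ3
      _ ≤ ε * a := by linarith only [mul_nonneg hε.le ha0]
  · -- Case `s < t` (`0 < s`): expansion based at `C_s`, plus the sup-norm continuity of the smoothed
    -- Hessian entries between the scales `s` and `t`
    set P1 : ℝ := (1 / 2) * ∑ i, ∑ j, (D.C t - D.C s) i j *
      ∫ w, D2 (y + w) (EuclideanSpace.single i 1) (EuclideanSpace.single j 1)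
        ∂(multivariateGaussian 0 (D.C s)) with hP1
    set P2 : ℝ := (1 / 2) * ∑ i, ∑ j, (D.C t - D.C s) i j *
      ((∫ w, D2 (y + w) (EuclideanSpace.single i 1) (EuclideanSpace.single j 1)
        ∂(multivariateGaussian 0 (D.C s))) -
       ∫ w, D2 (y + w) (EuclideanSpace.single i 1) (EuclideanSpace.single j 1)
        ∂(multivariateGaussian 0 (D.C t))) with hP2
    have hE := abs_integral_C_sub_integral_C_sub_sum_le D hG1 hG2 hD2m hGb hM hδ hUCδ hs0.le hst.le y
    obtain ⟨htr1, hl1⟩ := htr (D.C t - D.C s) (fun i j => by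
      simp only [Matrix.sub_apply]; rw [abs_sub_comm])
    have hE' : |Zt - Zs - P1| ≤ ε / 4 * a + ε / 4 * a := by
      rw [← hK4, ← hP1, ← hZs, ← hZt] at hE
      refine hE.trans ?_
      have h8 : (∑ i, ∑ j, |(D.C t - D.C s) i j|) ^ 2 ≤ (a * T2) ^ 2 :=
        pow_le_pow_left₀ (Finset.sum_nonneg fun i _ => Finset.sum_nonneg fun j _ =>
          abs_nonneg _) hl1 2
      have h9 : ε₁ * ∑ i, (D.C t - D.C s) i i ≤ ε₁ * (a * T) :=
        mul_le_mul_of_nonneg_left htr1 hε₁0.le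
      have h10 : 2 * M / δ ^ 2 * ((∑ i, ∑ j, |(D.C t - D.C s) i j|) ^ 2 * K4) ≤
          2 * M / δ ^ 2 * ((a * T2) ^ 2 * K4) :=
        mul_le_mul_of_nonneg_left (mul_le_mul_of_nonneg_right h8 hK40) (by positivity)
      linarith only [h9, h10, hN1, hN2]
    -- sup-norm continuity of the Hessian averages: |I_s − I_t| ≤ ε₃
    have hIs : ∀ i j, |(∫ w, D2 (y + w) (EuclideanSpace.single i 1) (EuclideanSpace.single j 1)
        ∂(multivariateGaussian 0 (D.C s))) -
        ∫ w, D2 (y + w) (EuclideanSpace.single i 1) (EuclideanSpace.single j 1)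
          ∂(multivariateGaussian 0 (D.C t))| ≤ ε₃ := by
      intro i j
      obtain ⟨hc2, hb2, -⟩ := eval₂_facts hM hUC i j
      have h := abs_integral_add_sub_integral_le hc2.measurable hb2 hδ₃ (hUCδ₃ i j)
        (D.posSemidef_C hs0.le) (D.posSemidef_C_sub hs0.le hst.le) y
      rw [add_sub_cancel] at h
      rw [abs_sub_comm]
      refine h.trans ?_
      have e : ∑ i, (D.C t - D.C s) i i = ∑ i, (D.C t i i - D.C s i i) :=
        Finset.sum_congr rfl fun i _ => by simp [Matrix.sub_apply]
      rw [e]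
      have h5 : 2 * M / δ₃ ^ 2 * ∑ i, (D.C t i i - D.C s i i) ≤ ε₃ / 2 :=
        le_trans (mul_le_mul_of_nonneg_left (le_abs_self _) (by positivity)) hsE.le
      linarith only [h5]
    have hE3 : |P2| ≤ ε / 4 * a := by
      rw [hP2, abs_mul, abs_of_pos (by norm_num : (0:ℝ) < 1 / 2)]
      have h6 : |∑ i, ∑ j, (D.C t - D.C s) i j *
          ((∫ w, D2 (y + w) (EuclideanSpace.single i 1) (EuclideanSpace.single j 1)
            ∂(multivariateGaussian 0 (D.C s))) -
           ∫ w, D2 (y + w) (EuclideanSpace.single i 1) (EuclideanSpace.single j 1)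
            ∂(multivariateGaussian 0 (D.C t)))| ≤ (a * T2) * ε₃ := by
        calc _ ≤ ∑ i, ∑ j, |(D.C t - D.C s) i j| * ε₃ := by
              refine (Finset.abs_sum_le_sum_abs _ _).trans (Finset.sum_le_sum fun i _ => ?_)
              refine (Finset.abs_sum_le_sum_abs _ _).trans (Finset.sum_le_sum fun j _ => ?_)
              rw [abs_mul]
              exact mul_le_mul_of_nonneg_left (hIs i j) (abs_nonneg _)
          _ = (∑ i, ∑ j, |(D.C t - D.C s) i j|) * ε₃ := by
              rw [Finset.sum_mul]
              exact Finset.sum_congr rfl fun i _ => by rw [Finset.sum_mul]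
          _ ≤ (a * T2) * ε₃ := mul_le_mul_of_nonneg_right hl1 hε₃0.le
      have h7 : (a * T2) * ε₃ = ε / 4 * a := by rw [hε₃]; field_simp
      calc (1 / 2) * |∑ i, ∑ j, (D.C t - D.C s) i j *
            ((∫ w, D2 (y + w) (EuclideanSpace.single i 1) (EuclideanSpace.single j 1)
              ∂(multivariateGaussian 0 (D.C s))) -
             ∫ w, D2 (y + w) (EuclideanSpace.single i 1) (EuclideanSpace.single j 1)
              ∂(multivariateGaussian 0 (D.C t)))| ≤ (1 / 2) * ((a * T2) * ε₃) :=
            mul_le_mul_of_nonneg_left h6 (by norm_num)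
        _ ≤ ε / 4 * a := by rw [h7]; linarith only [mul_nonneg hε.le ha0]
    -- the algebraic decomposition `Zs − Zt − Q = −(Zt − Zs − P1) − P2 + (P3 − Q)`
    have hP : P1 - P2 + P3 = 0 := by
      rw [hP1, hP2, hP3, ← mul_sub, ← mul_add, ← Finset.sum_sub_distrib, ← Finset.sum_add_distrib]
      have hin : ∀ i, ((∑ j, (D.C t - D.C s) i j *
            ∫ w, D2 (y + w) (EuclideanSpace.single i 1) (EuclideanSpace.single j 1)
              ∂(multivariateGaussian 0 (D.C s))) -
          ∑ j, (D.C t - D.C s) i j *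
            ((∫ w, D2 (y + w) (EuclideanSpace.single i 1) (EuclideanSpace.single j 1)
              ∂(multivariateGaussian 0 (D.C s))) -
             ∫ w, D2 (y + w) (EuclideanSpace.single i 1) (EuclideanSpace.single j 1)
              ∂(multivariateGaussian 0 (D.C t)))) +
          ∑ j, (D.C s i j - D.C t i j) *
            ∫ w, D2 (y + w) (EuclideanSpace.single i 1) (EuclideanSpace.single j 1)
              ∂(multivariateGaussian 0 (D.C t)) = 0 := by
        intro i
        rw [← Finset.sum_sub_distrib, ← Finset.sum_add_distrib]
        refine Finset.sum_eq_zero fun j _ => ?_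
        simp only [Matrix.sub_apply]
        ring
      rw [Finset.sum_eq_zero fun i _ => hin i, mul_zero]
    have hdec : Zs - Zt - Q = -(Zt - Zs - P1) + -P2 + (P3 - Q) := by
      linear_combination (-1 : ℝ) * hP
    rw [hdec]
    calc |-(Zt - Zs - P1) + -P2 + (P3 - Q)| ≤ |-(Zt - Zs - P1)| + |-P2| + |P3 - Q| :=
          abs_add_three (-(Zt - Zs - P1)) (-P2) (P3 - Q)
      _ = |Zt - Zs - P1| + |P2| + |P3 - Q| := by rw [abs_neg, abs_neg]
      _ ≤ (ε / 4 * a + ε / 4 * a) + ε / 4 * a + ε / 4 * a := add_le_add (add_le_add hE' hE3) hQ3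
      _ = ε * a := by ring

/-- **The joint derivative of `t ↦ E_{C_∞−C_t}[e^{−V_t} F(φ+·)]`** (covariance part + integrand part):
for `t > 0`,
`d/dt E_{C_∞−C_t}[Z_t F(φ+·)] = −½ Σ Ċ_t^{ij} E_{C_∞−C_t}[∂_i∂_j(Z_tF)(φ+·)] + E_{C_∞−C_t}[(∂_tZ_t) F(φ+·)]`,
`Z_t = e^{−V_t} = E_{C_t}[e^{−V₀}(·+w)]`, with `D²(Z_tF) = Z_tD²F + ∇Z_t⊗∇F + F D²Z_t + ∇F⊗∇Z_t` written out
(the two «time derivatives computed using Propositions 5 and 7» of [BBD]'s proof of Prop 8, p0015, here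
for the fluctuation covariance).  The moving integrand is handled through
`eventually_abs_integral_exp_neg_sub_sub_mul_le`. [cite: BauerschmidtBodineauDagallier2023, Proposition 8 (proof)] -/
theorem hasDerivAt_integral_renormDensity_mul
    (hG1 : ∀ x, HasFDerivAt (fun x => Real.exp (-V₀ x)) (D1 x) x)
    (hG2 : ∀ x, HasFDerivAt D1 (D2 x) x) {b : ℝ} (hb : ∀ φ, b ≤ V₀ φ)
    {K1 : ℝ} (hK1 : ∀ x, ‖D1 x‖ ≤ K1) {M : ℝ} (hM : ∀ x, ‖D2 x‖ ≤ M) (hUC : UniformContinuous D2)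
    (hF1 : ∀ x, HasFDerivAt F (DF x) x) (hF2 : ∀ x, HasFDerivAt DF (D2F x) x)
    {KF : ℝ} (hFb : ∀ x, |F x| ≤ KF) {LF : ℝ} (hDF : ∀ x, ‖DF x‖ ≤ LF)
    {MF : ℝ} (hD2F : ∀ x, ‖D2F x‖ ≤ MF) (hUCF : UniformContinuous D2F)
    {t : ℝ} (ht : 0 < t) (φ : EuclideanSpace ℝ (Fin N)) :
    HasDerivAt (fun s => ∫ x, Real.exp (-renormPotential D V₀ s (φ + x)) * F (φ + x)
        ∂(multivariateGaussian 0 (D.Cinf - D.C s)))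
      (-((1 / 2) * ∑ i, ∑ j, D.Cdot t i j *
          ∫ x, ((∫ ζ, Real.exp (-V₀ (φ + x + ζ)) ∂(multivariateGaussian 0 (D.C t))) • D2F (φ + x) +
              (∫ ζ, D1 (φ + x + ζ) ∂(multivariateGaussian 0 (D.C t))).smulRight (DF (φ + x)) +
              (F (φ + x) • (∫ ζ, D2 (φ + x + ζ) ∂(multivariateGaussian 0 (D.C t))) +
                (DF (φ + x)).smulRight (∫ ζ, D1 (φ + x + ζ) ∂(multivariateGaussian 0 (D.C t)))))
            (EuclideanSpace.single i 1) (EuclideanSpace.single j 1)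
            ∂(multivariateGaussian 0 (D.Cinf - D.C t))) +
        ∫ x, ((1 / 2) * ∑ i, ∑ j, D.Cdot t i j *
            ∫ w, D2 (φ + x + w) (EuclideanSpace.single i 1) (EuclideanSpace.single j 1)
              ∂(multivariateGaussian 0 (D.C t))) * F (φ + x)
          ∂(multivariateGaussian 0 (D.Cinf - D.C t))) t := by
  have hD2c : Continuous D2 := hUC.continuous
  -- measurability of `V₀`, bounds for `e^{−V₀}`
  have hc : Continuous fun x => Real.exp (-V₀ x) :=
    continuous_iff_continuousAt.2 fun x => (hG1 x).continuousAt
  have hV : Measurable V₀ := by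
    have he : V₀ = fun x => -Real.log (Real.exp (-V₀ x)) := by
      funext x; rw [Real.log_exp, neg_neg]
    rw [he]
    exact (Real.measurable_log.comp hc.measurable).neg
  -- the renormalised density at scale `t` and its derivatives
  have hZ1 : ∀ y, HasFDerivAt
      (fun y => ∫ ζ, Real.exp (-V₀ (y + ζ)) ∂(multivariateGaussian 0 (D.C t)))
      (∫ ζ, D1 (y + ζ) ∂(multivariateGaussian 0 (D.C t))) y :=
    fun y => hasFDerivAt_integral_exp_neg D hG1 hG2 hb hK1 t y
  have hZ2 : ∀ y, HasFDerivAt (fun y => ∫ ζ, D1 (y + ζ) ∂(multivariateGaussian 0 (D.C t)))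
      (∫ ζ, D2 (y + ζ) ∂(multivariateGaussian 0 (D.C t))) y :=
    fun y => hasFDerivAt_integral_fderiv_exp_neg D hG2 hK1 hM hD2c t y
  have hZpos : ∀ (r : ℝ) y, 0 < ∫ ζ, Real.exp (-V₀ (y + ζ)) ∂(multivariateGaussian 0 (D.C r)) :=
    fun r y => integral_exp_neg_pos hV hb _ y
  have hZle : ∀ (r : ℝ) y, (∫ ζ, Real.exp (-V₀ (y + ζ)) ∂(multivariateGaussian 0 (D.C r))) ≤
      Real.exp (-b) := fun r y => integral_exp_neg_le hV hb _ y
  have hZb : ∀ y, |∫ ζ, Real.exp (-V₀ (y + ζ)) ∂(multivariateGaussian 0 (D.C t))| ≤ Real.exp (-b) :=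
    fun y => by rw [abs_of_pos (hZpos t y)]; exact hZle t y
  have hDZb : ∀ y, ‖∫ ζ, D1 (y + ζ) ∂(multivariateGaussian 0 (D.C t))‖ ≤ K1 :=
    fun y => norm_integral_shift_le hK1 _ y
  have hHZb : ∀ y, ‖∫ ζ, D2 (y + ζ) ∂(multivariateGaussian 0 (D.C t))‖ ≤ M :=
    fun y => norm_integral_shift_le hM _ y
  -- the product `K = Z_t F` and its derivatives
  have hK1' : ∀ y, HasFDerivAt
      (fun y => (∫ ζ, Real.exp (-V₀ (y + ζ)) ∂(multivariateGaussian 0 (D.C t))) * F y)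
      ((∫ ζ, Real.exp (-V₀ (y + ζ)) ∂(multivariateGaussian 0 (D.C t))) • DF y +
        F y • ∫ ζ, D1 (y + ζ) ∂(multivariateGaussian 0 (D.C t))) y :=
    fun y => (hZ1 y).mul (hF1 y)
  have hK2' : ∀ y, HasFDerivAt
      (fun y => (∫ ζ, Real.exp (-V₀ (y + ζ)) ∂(multivariateGaussian 0 (D.C t))) • DF y +
        F y • ∫ ζ, D1 (y + ζ) ∂(multivariateGaussian 0 (D.C t)))
      ((∫ ζ, Real.exp (-V₀ (y + ζ)) ∂(multivariateGaussian 0 (D.C t))) • D2F y +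
          (∫ ζ, D1 (y + ζ) ∂(multivariateGaussian 0 (D.C t))).smulRight (DF y) +
        (F y • (∫ ζ, D2 (y + ζ) ∂(multivariateGaussian 0 (D.C t))) +
          (DF y).smulRight (∫ ζ, D1 (y + ζ) ∂(multivariateGaussian 0 (D.C t))))) y :=
    fun y => hasFDerivAt_fderiv_mul hZ1 hZ2 hF1 hF2 y
  have hKb : ∀ y, |(∫ ζ, Real.exp (-V₀ (y + ζ)) ∂(multivariateGaussian 0 (D.C t))) * F y| ≤
      Real.exp (-b) * KF := fun y => by
    rw [abs_mul]
    exact mul_le_mul (hZb y) (hFb y) (abs_nonneg _) (Real.exp_pos _).le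
  have hHKb := fun y => norm_fderiv₂_mul_le_of_bounds hZb hFb hDZb hDF hHZb hD2F y
  -- uniform continuity of the product Hessian
  have hZuc := uc_of_fderiv_bound hZ1 hDZb
  have hDZuc := uc_of_fderiv_bound hZ2 hHZb
  have hHZuc : UniformContinuous fun y => ∫ ζ, D2 (y + ζ) ∂(multivariateGaussian 0 (D.C t)) :=
    uniformContinuous_integral_shift hD2c hM hUC _
  have hFuc := uc_of_fderiv_bound hF1 hDF
  have hDFuc := uc_of_fderiv_bound hF2 hD2F
  have hHKuc : UniformContinuous fun y =>
      (∫ ζ, Real.exp (-V₀ (y + ζ)) ∂(multivariateGaussian 0 (D.C t))) • D2F y +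
          (∫ ζ, D1 (y + ζ) ∂(multivariateGaussian 0 (D.C t))).smulRight (DF y) +
        (F y • (∫ ζ, D2 (y + ζ) ∂(multivariateGaussian 0 (D.C t))) +
          (DF y).smulRight (∫ ζ, D1 (y + ζ) ∂(multivariateGaussian 0 (D.C t)))) :=
    ((uc_smul hZuc hUCF hZb hD2F).add (uc_smulRight hDZuc hDFuc hDZb hDF)).add
      ((uc_smul hFuc hHZuc hFb hHZb).add (uc_smulRight hDFuc hDZuc hDF hDZb))
  -- (1) covariance part: fixed integrand `K = Z_tF`, moving covariance `C_∞ − C_s`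
  have hv := hasDerivAt_integral_gaussian_Cinf_sub D hK1' hK2' hKb hHKb hHKuc ht φ
  -- (2) the function, rewritten with `e^{−V_s} = Z_s`
  have hfun : (fun s => ∫ x, Real.exp (-renormPotential D V₀ s (φ + x)) * F (φ + x)
      ∂(multivariateGaussian 0 (D.Cinf - D.C s))) =
      fun s => ∫ x, (∫ ζ, Real.exp (-V₀ (φ + x + ζ)) ∂(multivariateGaussian 0 (D.C s))) *
        F (φ + x) ∂(multivariateGaussian 0 (D.Cinf - D.C s)) := by
    funext s
    simp_rw [exp_neg_renormPotential D hV hb]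
  rw [hfun]
  -- measurability / integrability helpers
  have hZc : ∀ r : ℝ, Continuous fun y => ∫ ζ, Real.exp (-V₀ (y + ζ)) ∂(multivariateGaussian 0 (D.C r)) :=
    fun r => continuous_iff_continuousAt.2 fun y =>
      (hasFDerivAt_integral_exp_neg D hG1 hG2 hb hK1 r y).continuousAt
  have hFc : Continuous F := continuous_iff_continuousAt.2 fun x => (hF1 x).continuousAt
  have hIc : ∀ i j, Continuous fun y => ∫ w, D2 (y + w) (EuclideanSpace.single i 1)
      (EuclideanSpace.single j 1) ∂(multivariateGaussian 0 (D.C t)) := by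
    intro i j
    obtain ⟨hc2, hb2, huc2⟩ := eval₂_facts hM hUC i j
    exact (uniformContinuous_integral_shift hc2 (fun x => by
      rw [Real.norm_eq_abs]; exact hb2 x) huc2 (multivariateGaussian 0 (D.C t))).continuous
  have hZdc : Continuous fun y => (1 / 2) * ∑ i, ∑ j, D.Cdot t i j *
      ∫ w, D2 (y + w) (EuclideanSpace.single i 1) (EuclideanSpace.single j 1)
        ∂(multivariateGaussian 0 (D.C t)) :=
    continuous_const.mul (continuous_finsetSum _ fun i _ => continuous_finsetSum _ fun j _ =>
      continuous_const.mul (hIc i j))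
  obtain ⟨Mc, hMc⟩ := D.bounded_Cdot
  have hZdb : ∀ y, |(1 / 2) * ∑ i, ∑ j, D.Cdot t i j *
      ∫ w, D2 (y + w) (EuclideanSpace.single i 1) (EuclideanSpace.single j 1)
        ∂(multivariateGaussian 0 (D.C t))| ≤ (1 / 2) * ∑ _i : Fin N, ∑ _j : Fin N, Mc * M :=
    fun y => abs_half_sum_Cdot_integral_le D hM hD2c hMc ht.le y
  -- integrable pieces over a probability measure
  have hInt : ∀ (G : EuclideanSpace ℝ (Fin N) → ℝ), Continuous G → ∀ C : ℝ, (∀ y, |G y| ≤ C) →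
      ∀ (P : Measure (EuclideanSpace ℝ (Fin N))) [IsProbabilityMeasure P],
        Integrable (fun x => G (φ + x)) P := by
    intro G hGc C hGC P _
    exact Integrable.of_bound (hGc.comp (continuous_const.add continuous_id)).aestronglyMeasurable C
      (Eventually.of_forall fun x => by rw [Real.norm_eq_abs]; exact hGC (φ + x))
  -- (3) the difference `u − v` and the slope decomposition
  set u : ℝ → ℝ := fun s => ∫ x, (∫ ζ, Real.exp (-V₀ (φ + x + ζ)) ∂(multivariateGaussian 0 (D.C s))) *
    F (φ + x) ∂(multivariateGaussian 0 (D.Cinf - D.C s)) with hu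
  set v : ℝ → ℝ := fun s => ∫ x, (∫ ζ, Real.exp (-V₀ (φ + x + ζ)) ∂(multivariateGaussian 0 (D.C t))) *
    F (φ + x) ∂(multivariateGaussian 0 (D.Cinf - D.C s)) with hvdef
  set W : ℝ := ∫ x, ((1 / 2) * ∑ i, ∑ j, D.Cdot t i j *
      ∫ w, D2 (φ + x + w) (EuclideanSpace.single i 1) (EuclideanSpace.single j 1)
        ∂(multivariateGaussian 0 (D.C t))) * F (φ + x) ∂(multivariateGaussian 0 (D.Cinf - D.C t))
    with hW
  have huv : ∀ s, u s - v s = ∫ x, ((∫ ζ, Real.exp (-V₀ (φ + x + ζ)) ∂(multivariateGaussian 0 (D.C s))) -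
      (∫ ζ, Real.exp (-V₀ (φ + x + ζ)) ∂(multivariateGaussian 0 (D.C t)))) * F (φ + x)
        ∂(multivariateGaussian 0 (D.Cinf - D.C s)) := by
    intro s
    rw [hu, hvdef]
    simp only
    rw [← integral_sub]
    · refine integral_congr_ae (Eventually.of_forall fun x => ?_)
      simp only
      ring
    · exact hInt (fun y => (∫ ζ, Real.exp (-V₀ (y + ζ)) ∂(multivariateGaussian 0 (D.C s))) * F y)
        ((hZc s).mul hFc) (Real.exp (-b) * KF) (fun y => by
          rw [abs_mul, abs_of_pos (hZpos s y)]
          exact mul_le_mul (hZle s y) (hFb y) (abs_nonneg _) (Real.exp_pos _).le) _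
    · exact hInt (fun y => (∫ ζ, Real.exp (-V₀ (y + ζ)) ∂(multivariateGaussian 0 (D.C t))) * F y)
        ((hZc t).mul hFc) (Real.exp (-b) * KF) hKb _
  have hut : u t = v t := by rw [hu, hvdef]
  rw [hasDerivAt_iff_tendsto_slope]
  have hvs := hasDerivAt_iff_tendsto_slope.mp hv
  have hslope : ∀ s, slope u t s = slope v t s + (s - t)⁻¹ * (u s - v s) := by
    intro s
    rw [slope_def_field, slope_def_field, hut]
    ring
  -- (4) the integrand part: `(s−t)⁻¹ (u s − v s) → W`
  have hX : Tendsto (fun s => (s - t)⁻¹ * (u s - v s)) (𝓝[≠] t) (𝓝 W) := by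
    have hKF0 : 0 ≤ KF := le_trans (abs_nonneg _) (hFb 0)
    have hFb' : ∀ x, ‖F x‖ ≤ KF := fun x => by rw [Real.norm_eq_abs]; exact hFb x
    -- uniform continuity of `Ż_t` and of `Ż_t F`
    have hIuc : ∀ i j, UniformContinuous fun y => ∫ w, D2 (y + w) (EuclideanSpace.single i 1)
        (EuclideanSpace.single j 1) ∂(multivariateGaussian 0 (D.C t)) := by
      intro i j
      obtain ⟨hc2, hb2, huc2⟩ := eval₂_facts hM hUC i j
      exact uniformContinuous_integral_shift hc2 (fun x => by
        rw [Real.norm_eq_abs]; exact hb2 x) huc2 (multivariateGaussian 0 (D.C t))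
    have hZduc : UniformContinuous fun y => (1 / 2) * ∑ i, ∑ j, D.Cdot t i j *
        ∫ w, D2 (y + w) (EuclideanSpace.single i 1) (EuclideanSpace.single j 1)
          ∂(multivariateGaussian 0 (D.C t)) :=
      (uc_finset_sum _ (fun i y => ∑ j, D.Cdot t i j *
        ∫ w, D2 (y + w) (EuclideanSpace.single i 1) (EuclideanSpace.single j 1)
          ∂(multivariateGaussian 0 (D.C t))) fun i _ =>
        uc_finset_sum _ (fun j y => D.Cdot t i j *
          ∫ w, D2 (y + w) (EuclideanSpace.single i 1) (EuclideanSpace.single j 1)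
            ∂(multivariateGaussian 0 (D.C t))) fun j _ => (hIuc i j).const_mul' _).const_mul' _
    have hHuc : UniformContinuous fun y => ((1 / 2) * ∑ i, ∑ j, D.Cdot t i j *
        ∫ w, D2 (y + w) (EuclideanSpace.single i 1) (EuclideanSpace.single j 1)
          ∂(multivariateGaussian 0 (D.C t))) * F y :=
      uc_smul (Y := ℝ) hZduc hFuc hZdb hFb'
    have hHb : ∀ y, |((1 / 2) * ∑ i, ∑ j, D.Cdot t i j *
        ∫ w, D2 (y + w) (EuclideanSpace.single i 1) (EuclideanSpace.single j 1)
          ∂(multivariateGaussian 0 (D.C t))) * F y| ≤ ((1 / 2) * ∑ _i : Fin N, ∑ _j : Fin N, Mc * M) * KF :=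
      fun y => by
      rw [abs_mul]
      exact mul_le_mul (hZdb y) (hFb y) (abs_nonneg _) ((abs_nonneg _).trans (hZdb y))
    -- continuity of `s ↦ E_{C_∞−C_s}[Ż_t F(φ+·)]` at `t`
    have hcont : Tendsto (fun s => ∫ x, ((1 / 2) * ∑ i, ∑ j, D.Cdot t i j *
        ∫ w, D2 (φ + x + w) (EuclideanSpace.single i 1) (EuclideanSpace.single j 1)
          ∂(multivariateGaussian 0 (D.C t))) * F (φ + x) ∂(multivariateGaussian 0 (D.Cinf - D.C s)))
        (𝓝[≠] t) (𝓝 W) := by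
      have h := tendsto_integral_gaussian_Cinf_sub_Ici D (H := fun y => ((1 / 2) * ∑ i, ∑ j,
        D.Cdot t i j * ∫ w, D2 (y + w) (EuclideanSpace.single i 1) (EuclideanSpace.single j 1)
          ∂(multivariateGaussian 0 (D.C t))) * F y) (hZdc.mul hFc).measurable hHb hHuc ht.le φ
      rw [nhdsWithin_eq_nhds.2 (Ici_mem_nhds ht)] at h
      exact h.mono_left nhdsWithin_le_nhds
    rw [Metric.tendsto_nhds]
    intro ε hε
    set ε' : ℝ := ε / (2 * (KF + 1)) with hε'
    have hε'0 : 0 < ε' := by positivity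
    have hU := eventually_abs_integral_exp_neg_sub_sub_mul_le D hG1 hG2 hb hM hUC ht hε'0
    have ev1 := hU.filter_mono (nhdsWithin_le_nhds (s := ({t}ᶜ : Set ℝ)) (a := t))
    have ev2 := Metric.tendsto_nhds.mp hcont _ (half_pos hε)
    have ev3 : ∀ᶠ s in 𝓝[≠] t, s ≠ t := self_mem_nhdsWithin
    filter_upwards [ev1, ev2, ev3] with s hs1 hs2 hs3
    have hst : s - t ≠ 0 := sub_ne_zero.2 hs3
    rw [huv s, ← integral_const_mul, Real.dist_eq]
    rw [Real.dist_eq] at hs2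
    -- integrability of the two integrands over `γ_{C_∞ − C_s}`
    have hI1 : Integrable (fun x => (s - t)⁻¹ *
        (((∫ ζ, Real.exp (-V₀ (φ + x + ζ)) ∂(multivariateGaussian 0 (D.C s))) -
          ∫ ζ, Real.exp (-V₀ (φ + x + ζ)) ∂(multivariateGaussian 0 (D.C t))) * F (φ + x)))
        (multivariateGaussian 0 (D.Cinf - D.C s)) :=
      hInt (fun y => (s - t)⁻¹ * (((∫ ζ, Real.exp (-V₀ (y + ζ)) ∂(multivariateGaussian 0 (D.C s))) -
          ∫ ζ, Real.exp (-V₀ (y + ζ)) ∂(multivariateGaussian 0 (D.C t))) * F y))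
        (continuous_const.mul (((hZc s).sub (hZc t)).mul hFc))
        (|(s - t)⁻¹| * ((Real.exp (-b) + Real.exp (-b)) * KF)) (fun y => by
          rw [abs_mul, abs_mul]
          refine mul_le_mul_of_nonneg_left ?_ (abs_nonneg _)
          refine mul_le_mul ?_ (hFb y) (abs_nonneg _) (by positivity)
          calc |(∫ ζ, Real.exp (-V₀ (y + ζ)) ∂(multivariateGaussian 0 (D.C s))) -
                ∫ ζ, Real.exp (-V₀ (y + ζ)) ∂(multivariateGaussian 0 (D.C t))|
              ≤ |∫ ζ, Real.exp (-V₀ (y + ζ)) ∂(multivariateGaussian 0 (D.C s))| +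
                |∫ ζ, Real.exp (-V₀ (y + ζ)) ∂(multivariateGaussian 0 (D.C t))| := abs_sub _ _
            _ ≤ Real.exp (-b) + Real.exp (-b) := by
                rw [abs_of_pos (hZpos s y), abs_of_pos (hZpos t y)]
                exact add_le_add (hZle s y) (hZle t y)) _
    have hI2 : Integrable (fun x => ((1 / 2) * ∑ i, ∑ j, D.Cdot t i j *
        ∫ w, D2 (φ + x + w) (EuclideanSpace.single i 1) (EuclideanSpace.single j 1)
          ∂(multivariateGaussian 0 (D.C t))) * F (φ + x)) (multivariateGaussian 0 (D.Cinf - D.C s)) :=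
      hInt (fun y => ((1 / 2) * ∑ i, ∑ j, D.Cdot t i j *
        ∫ w, D2 (y + w) (EuclideanSpace.single i 1) (EuclideanSpace.single j 1)
          ∂(multivariateGaussian 0 (D.C t))) * F y) (hZdc.mul hFc) _ hHb _
    -- the pointwise bound from the uniform differentiability of `Z`
    have hpt : ∀ x, |(s - t)⁻¹ *
        (((∫ ζ, Real.exp (-V₀ (φ + x + ζ)) ∂(multivariateGaussian 0 (D.C s))) -
          ∫ ζ, Real.exp (-V₀ (φ + x + ζ)) ∂(multivariateGaussian 0 (D.C t))) * F (φ + x)) -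
        ((1 / 2) * ∑ i, ∑ j, D.Cdot t i j *
          ∫ w, D2 (φ + x + w) (EuclideanSpace.single i 1) (EuclideanSpace.single j 1)
            ∂(multivariateGaussian 0 (D.C t))) * F (φ + x)| ≤ ε' * KF := by
      intro x
      have h1 := hs1 (φ + x)
      have hid : (s - t)⁻¹ *
          (((∫ ζ, Real.exp (-V₀ (φ + x + ζ)) ∂(multivariateGaussian 0 (D.C s))) -
            ∫ ζ, Real.exp (-V₀ (φ + x + ζ)) ∂(multivariateGaussian 0 (D.C t))) * F (φ + x)) -
          ((1 / 2) * ∑ i, ∑ j, D.Cdot t i j *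
            ∫ w, D2 (φ + x + w) (EuclideanSpace.single i 1) (EuclideanSpace.single j 1)
              ∂(multivariateGaussian 0 (D.C t))) * F (φ + x) =
          (s - t)⁻¹ * (((∫ ζ, Real.exp (-V₀ (φ + x + ζ)) ∂(multivariateGaussian 0 (D.C s))) -
            (∫ ζ, Real.exp (-V₀ (φ + x + ζ)) ∂(multivariateGaussian 0 (D.C t))) -
            (s - t) * ((1 / 2) * ∑ i, ∑ j, D.Cdot t i j *
              ∫ w, D2 (φ + x + w) (EuclideanSpace.single i 1) (EuclideanSpace.single j 1)
                ∂(multivariateGaussian 0 (D.C t)))) * F (φ + x)) := by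
        field_simp
      rw [hid, abs_mul, abs_mul, abs_inv]
      calc |s - t|⁻¹ * (|_| * |F (φ + x)|) ≤ |s - t|⁻¹ * ((ε' * |s - t|) * KF) := by
            refine mul_le_mul_of_nonneg_left ?_ (inv_nonneg.2 (abs_nonneg _))
            exact mul_le_mul h1 (hFb _) (abs_nonneg _) (by positivity)
        _ = ε' * KF := by
            have hane : |s - t| ≠ 0 := abs_ne_zero.2 hst
            field_simp
    have hT1 := abs_integral_le_of_abs_le (multivariateGaussian 0 (D.Cinf - D.C s)) hpt
    rw [integral_sub hI1 hI2] at hT1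
    have hε'KF : ε' * KF < ε / 2 := by
      rw [hε', div_mul_eq_mul_div, div_lt_div_iff₀ (by positivity) (by positivity)]
      nlinarith
    calc _ ≤ |(∫ x, (s - t)⁻¹ *
            (((∫ ζ, Real.exp (-V₀ (φ + x + ζ)) ∂(multivariateGaussian 0 (D.C s))) -
              ∫ ζ, Real.exp (-V₀ (φ + x + ζ)) ∂(multivariateGaussian 0 (D.C t))) * F (φ + x))
              ∂(multivariateGaussian 0 (D.Cinf - D.C s))) -
            ∫ x, ((1 / 2) * ∑ i, ∑ j, D.Cdot t i j *
              ∫ w, D2 (φ + x + w) (EuclideanSpace.single i 1) (EuclideanSpace.single j 1)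
                ∂(multivariateGaussian 0 (D.C t))) * F (φ + x) ∂(multivariateGaussian 0 (D.Cinf - D.C s))| +
          |(∫ x, ((1 / 2) * ∑ i, ∑ j, D.Cdot t i j *
              ∫ w, D2 (φ + x + w) (EuclideanSpace.single i 1) (EuclideanSpace.single j 1)
                ∂(multivariateGaussian 0 (D.C t))) * F (φ + x) ∂(multivariateGaussian 0 (D.Cinf - D.C s))) -
            W| := abs_sub_le _ _ _
      _ < ε' * KF + ε / 2 := add_lt_add_of_le_of_lt hT1 hs2
      _ < ε := by linarith
  refine (hvs.add hX).congr' ?_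
  exact Eventually.of_forall fun s => (hslope s).symm

/-- **[BBD] Proposition 8 — the dual generator identity `−∂_t E_{ν_t}[F] = E_{ν_t}[L_t F]`.**
Let `C_t` be a covariance decomposition (`Polchinski.CovDecomposition`, possibly degenerate `Ċ_t`),
`V₀` bounded below with `e^{−V₀}` twice Fréchet differentiable (`∇e^{−V₀}` bounded, `D²e^{−V₀}` bounded and
uniformly continuous), and `F` bounded, twice Fréchet differentiable with `∇F` bounded and `D²F` bounded
and uniformly continuous.  Then for every `t > 0` the renormalised expectation
`E_{ν_t}[F] = e^{V_∞(0)} E_{C_∞−C_t}[e^{−V_t} F]` (`Polchinski.renormExpect`) satisfies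
`d/dt E_{ν_t}[F] = −E_{ν_t}[L_t F]`, where
`L_tF(y) = ½ Σ_{ij} Ċ_t^{ij} ∂_i∂_jF(y) − Σ_{ij} Ċ_t^{ij} ∂_iV_t(y) ∂_jF(y) = ½Δ_{Ċ_t}F − (∇V_t, ∇F)_{Ċ_t}`
((e:polchinski-L)) and `∇V_t(y) = −∇Z_t(y)/Z_t(y)` is the derivative of the renormalised potential certified
by `hasFDerivAt_renormPotential` — the second identity of (e:polchinski-semigroup), «`−∂_tν_t = L_t^*ν_t`».
[cite: BauerschmidtBodineauDagallier2023, Proposition 8] -/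
theorem hasDerivAt_renormExpect
    (hG1 : ∀ x, HasFDerivAt (fun x => Real.exp (-V₀ x)) (D1 x) x)
    (hG2 : ∀ x, HasFDerivAt D1 (D2 x) x) {b : ℝ} (hb : ∀ φ, b ≤ V₀ φ)
    {K1 : ℝ} (hK1 : ∀ x, ‖D1 x‖ ≤ K1) {M : ℝ} (hM : ∀ x, ‖D2 x‖ ≤ M) (hUC : UniformContinuous D2)
    (hF1 : ∀ x, HasFDerivAt F (DF x) x) (hF2 : ∀ x, HasFDerivAt DF (D2F x) x)
    {KF : ℝ} (hFb : ∀ x, |F x| ≤ KF) {LF : ℝ} (hDF : ∀ x, ‖DF x‖ ≤ LF)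
    {MF : ℝ} (hD2F : ∀ x, ‖D2F x‖ ≤ MF) (hUCF : UniformContinuous D2F)
    {t : ℝ} (ht : 0 < t) :
    HasDerivAt (fun s => renormExpect D V₀ s F)
      (-(renormExpect D V₀ t fun y =>
          (1 / 2) * ∑ i, ∑ j, D.Cdot t i j *
              D2F y (EuclideanSpace.single i 1) (EuclideanSpace.single j 1) -
            ∑ i, ∑ j, D.Cdot t i j *
              (-((∫ ζ, Real.exp (-V₀ (y + ζ)) ∂(multivariateGaussian 0 (D.C t)))⁻¹ •
                  ∫ ζ, D1 (y + ζ) ∂(multivariateGaussian 0 (D.C t)))) (EuclideanSpace.single i 1) *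
                DF y (EuclideanSpace.single j 1))) t := by
  have hD2c : Continuous D2 := hUC.continuous
  have hc : Continuous fun x => Real.exp (-V₀ x) :=
    continuous_iff_continuousAt.2 fun x => (hG1 x).continuousAt
  have hV : Measurable V₀ := by
    have he : V₀ = fun x => -Real.log (Real.exp (-V₀ x)) := by
      funext x; rw [Real.log_exp, neg_neg]
    rw [he]
    exact (Real.measurable_log.comp hc.measurable).neg
  -- the joint derivative at base point `0`
  have hA := hasDerivAt_integral_renormDensity_mul D hG1 hG2 hb hK1 hM hUC hF1 hF2 hFb hDF hD2F hUCF
    ht 0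
  simp only [zero_add] at hA
  have hB := hA.const_mul (Real.exp (renormPotentialInf D V₀ 0))
  refine hB.congr_deriv ?_
  unfold renormExpect
  rw [← mul_neg]
  -- facts about `Z_t`, `∇Z_t`, `Hess Z_t`, `F`
  have hZ1 : ∀ y, HasFDerivAt
      (fun y => ∫ ζ, Real.exp (-V₀ (y + ζ)) ∂(multivariateGaussian 0 (D.C t)))
      (∫ ζ, D1 (y + ζ) ∂(multivariateGaussian 0 (D.C t))) y :=
    fun y => hasFDerivAt_integral_exp_neg D hG1 hG2 hb hK1 t y
  have hZ2 : ∀ y, HasFDerivAt (fun y => ∫ ζ, D1 (y + ζ) ∂(multivariateGaussian 0 (D.C t)))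
      (∫ ζ, D2 (y + ζ) ∂(multivariateGaussian 0 (D.C t))) y :=
    fun y => hasFDerivAt_integral_fderiv_exp_neg D hG2 hK1 hM hD2c t y
  have hZpos : ∀ y, 0 < ∫ ζ, Real.exp (-V₀ (y + ζ)) ∂(multivariateGaussian 0 (D.C t)) :=
    fun y => integral_exp_neg_pos hV hb _ y
  have hZc : Continuous fun y => ∫ ζ, Real.exp (-V₀ (y + ζ)) ∂(multivariateGaussian 0 (D.C t)) :=
    continuous_iff_continuousAt.2 fun y => (hZ1 y).continuousAt
  have hDZc : Continuous fun y => ∫ ζ, D1 (y + ζ) ∂(multivariateGaussian 0 (D.C t)) :=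
    continuous_iff_continuousAt.2 fun y => (hZ2 y).continuousAt
  have hHZc : Continuous fun y => ∫ ζ, D2 (y + ζ) ∂(multivariateGaussian 0 (D.C t)) :=
    (uniformContinuous_integral_shift hD2c hM hUC _).continuous
  have hFc : Continuous F := continuous_iff_continuousAt.2 fun x => (hF1 x).continuousAt
  have hDFc : Continuous DF := continuous_iff_continuousAt.2 fun x => (hF2 x).continuousAt
  have hD2Fc : Continuous D2F := hUCF.continuous
  -- evaluation of the integrated Hessian of `e^{−V₀}` on basis vectors
  have hHZij : ∀ (y : EuclideanSpace ℝ (Fin N)) (i j : Fin N),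
      (∫ ζ, D2 (y + ζ) ∂(multivariateGaussian 0 (D.C t))) (EuclideanSpace.single i 1)
        (EuclideanSpace.single j 1) =
      ∫ ζ, D2 (y + ζ) (EuclideanSpace.single i 1) (EuclideanSpace.single j 1)
        ∂(multivariateGaussian 0 (D.C t)) := by
    intro y i j
    have hI : Integrable (fun ζ => D2 (y + ζ)) (multivariateGaussian 0 (D.C t)) :=
      Integrable.of_bound (hD2c.comp (continuous_const.add continuous_id)).aestronglyMeasurable M
        (Eventually.of_forall fun ζ => hM (y + ζ))
    have hI1 : Integrable (fun ζ => D2 (y + ζ) (EuclideanSpace.single i 1))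
        (multivariateGaussian 0 (D.C t)) :=
      (ContinuousLinearMap.apply ℝ (EuclideanSpace ℝ (Fin N) →L[ℝ] ℝ)
        (EuclideanSpace.single i (1:ℝ))).integrable_comp hI
    rw [ContinuousLinearMap.integral_apply hI, ContinuousLinearMap.integral_apply hI1]
  -- continuity of scalar evaluations
  have hev1 : ∀ (u : EuclideanSpace ℝ (Fin N)), Continuous fun L : EuclideanSpace ℝ (Fin N) →L[ℝ] ℝ => L u :=
    fun u => (ContinuousLinearMap.apply ℝ ℝ u).continuous
  have hev2 : ∀ (u w : EuclideanSpace ℝ (Fin N)), Continuous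
      fun L : EuclideanSpace ℝ (Fin N) →L[ℝ] EuclideanSpace ℝ (Fin N) →L[ℝ] ℝ => L u w :=
    fun u w => (ContinuousLinearMap.apply ℝ ℝ w).continuous.comp
      (ContinuousLinearMap.apply ℝ (EuclideanSpace ℝ (Fin N) →L[ℝ] ℝ) u).continuous
  -- integrability over the probability measure `γ_{C_∞ − C_t}` of continuous bounded integrands
  have hInt : ∀ (G : EuclideanSpace ℝ (Fin N) → ℝ), Continuous G → ∀ C : ℝ, (∀ y, |G y| ≤ C) →
      Integrable G (multivariateGaussian 0 (D.Cinf - D.C t)) := fun G hGc C hGC =>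
    Integrable.of_bound hGc.aestronglyMeasurable C
      (Eventually.of_forall fun x => by rw [Real.norm_eq_abs]; exact hGC x)
  -- bounds
  obtain ⟨Mc, hMc⟩ := D.bounded_Cdot
  have hZb : ∀ y, |∫ ζ, Real.exp (-V₀ (y + ζ)) ∂(multivariateGaussian 0 (D.C t))| ≤ Real.exp (-b) :=
    fun y => by rw [abs_of_pos (hZpos y)]; exact integral_exp_neg_le hV hb _ y
  have hDZb : ∀ y, ‖∫ ζ, D1 (y + ζ) ∂(multivariateGaussian 0 (D.C t))‖ ≤ K1 :=
    fun y => norm_integral_shift_le hK1 _ y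
  have hHZb : ∀ y, ‖∫ ζ, D2 (y + ζ) ∂(multivariateGaussian 0 (D.C t))‖ ≤ M :=
    fun y => norm_integral_shift_le hM _ y
  have hHKb := fun y => norm_fderiv₂_mul_le_of_bounds hZb hFb hDZb hDF hHZb hD2F y
  have hevb : ∀ (L : EuclideanSpace ℝ (Fin N) →L[ℝ] EuclideanSpace ℝ (Fin N) →L[ℝ] ℝ) (i j : Fin N),
      |L (EuclideanSpace.single i 1) (EuclideanSpace.single j 1)| ≤ ‖L‖ := fun L i j => by
    rw [← Real.norm_eq_abs]
    calc ‖L (EuclideanSpace.single i 1) (EuclideanSpace.single j 1)‖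
        ≤ ‖L (EuclideanSpace.single i 1)‖ * ‖EuclideanSpace.single j (1:ℝ)‖ :=
          ContinuousLinearMap.le_opNorm _ _
      _ ≤ ‖L‖ * ‖EuclideanSpace.single i (1:ℝ)‖ * ‖EuclideanSpace.single j (1:ℝ)‖ :=
          mul_le_mul_of_nonneg_right (ContinuousLinearMap.le_opNorm _ _) (norm_nonneg _)
      _ = ‖L‖ := by simp
  have hevb1 : ∀ (L : EuclideanSpace ℝ (Fin N) →L[ℝ] ℝ) (i : Fin N),
      |L (EuclideanSpace.single i 1)| ≤ ‖L‖ := fun L i => by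
    rw [← Real.norm_eq_abs]
    calc ‖L (EuclideanSpace.single i 1)‖ ≤ ‖L‖ * ‖EuclideanSpace.single i (1:ℝ)‖ :=
          ContinuousLinearMap.le_opNorm _ _
      _ = ‖L‖ := by simp
  -- the entries of the product Hessian: continuity and integrability
  have hHKc : ∀ i j, Continuous fun y =>
      ((∫ ζ, Real.exp (-V₀ (y + ζ)) ∂(multivariateGaussian 0 (D.C t))) • D2F y +
          (∫ ζ, D1 (y + ζ) ∂(multivariateGaussian 0 (D.C t))).smulRight (DF y) +
        (F y • (∫ ζ, D2 (y + ζ) ∂(multivariateGaussian 0 (D.C t))) +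
          (DF y).smulRight (∫ ζ, D1 (y + ζ) ∂(multivariateGaussian 0 (D.C t)))))
        (EuclideanSpace.single i 1) (EuclideanSpace.single j 1) := by
    intro i j
    exact ((hZc.mul ((hev2 _ _).comp hD2Fc)).add (((hev1 _).comp hDZc).mul ((hev1 _).comp hDFc))).add
      ((hFc.mul ((hev2 _ _).comp hHZc)).add (((hev1 _).comp hDFc).mul ((hev1 _).comp hDZc)))
  have hHKint : ∀ i j, Integrable (fun y => D.Cdot t i j *
      ((∫ ζ, Real.exp (-V₀ (y + ζ)) ∂(multivariateGaussian 0 (D.C t))) • D2F y +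
          (∫ ζ, D1 (y + ζ) ∂(multivariateGaussian 0 (D.C t))).smulRight (DF y) +
        (F y • (∫ ζ, D2 (y + ζ) ∂(multivariateGaussian 0 (D.C t))) +
          (DF y).smulRight (∫ ζ, D1 (y + ζ) ∂(multivariateGaussian 0 (D.C t)))))
        (EuclideanSpace.single i 1) (EuclideanSpace.single j 1))
      (multivariateGaussian 0 (D.Cinf - D.C t)) := fun i j =>
    (hInt _ (hHKc i j) _ (fun y => (hevb _ i j).trans (hHKb y))).const_mul _
  -- `Ż_t F` is integrable
  have hIc : ∀ i j, Continuous fun y => ∫ w, D2 (y + w) (EuclideanSpace.single i 1)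
      (EuclideanSpace.single j 1) ∂(multivariateGaussian 0 (D.C t)) := by
    intro i j
    have h := (hev2 (EuclideanSpace.single i 1) (EuclideanSpace.single j 1)).comp hHZc
    refine h.congr fun y => ?_
    exact hHZij y i j
  have hZdc : Continuous fun y => (1 / 2) * ∑ i, ∑ j, D.Cdot t i j *
      ∫ w, D2 (y + w) (EuclideanSpace.single i 1) (EuclideanSpace.single j 1)
        ∂(multivariateGaussian 0 (D.C t)) :=
    continuous_const.mul (continuous_finsetSum _ fun i _ => continuous_finsetSum _ fun j _ =>
      continuous_const.mul (hIc i j))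
  have hZdb : ∀ y, |(1 / 2) * ∑ i, ∑ j, D.Cdot t i j *
      ∫ w, D2 (y + w) (EuclideanSpace.single i 1) (EuclideanSpace.single j 1)
        ∂(multivariateGaussian 0 (D.C t))| ≤ (1 / 2) * ∑ _i : Fin N, ∑ _j : Fin N, Mc * M :=
    fun y => abs_half_sum_Cdot_integral_le D hM hD2c hMc ht.le y
  have hZdFint : Integrable (fun y => ((1 / 2) * ∑ i, ∑ j, D.Cdot t i j *
      ∫ w, D2 (y + w) (EuclideanSpace.single i 1) (EuclideanSpace.single j 1)
        ∂(multivariateGaussian 0 (D.C t))) * F y) (multivariateGaussian 0 (D.Cinf - D.C t)) :=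
    hInt _ (hZdc.mul hFc) (((1 / 2) * ∑ _i : Fin N, ∑ _j : Fin N, Mc * M) * KF) fun y => by
      rw [abs_mul]
      exact mul_le_mul (hZdb y) (hFb y) (abs_nonneg _) ((abs_nonneg _).trans (hZdb y))
  -- swap the finite sums and the integral
  have hswap : ∑ i, ∑ j, D.Cdot t i j * ∫ y,
      ((∫ ζ, Real.exp (-V₀ (y + ζ)) ∂(multivariateGaussian 0 (D.C t))) • D2F y +
          (∫ ζ, D1 (y + ζ) ∂(multivariateGaussian 0 (D.C t))).smulRight (DF y) +
        (F y • (∫ ζ, D2 (y + ζ) ∂(multivariateGaussian 0 (D.C t))) +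
          (DF y).smulRight (∫ ζ, D1 (y + ζ) ∂(multivariateGaussian 0 (D.C t)))))
        (EuclideanSpace.single i 1) (EuclideanSpace.single j 1) ∂(multivariateGaussian 0 (D.Cinf - D.C t)) =
      ∫ y, ∑ i, ∑ j, D.Cdot t i j *
        ((∫ ζ, Real.exp (-V₀ (y + ζ)) ∂(multivariateGaussian 0 (D.C t))) • D2F y +
            (∫ ζ, D1 (y + ζ) ∂(multivariateGaussian 0 (D.C t))).smulRight (DF y) +
          (F y • (∫ ζ, D2 (y + ζ) ∂(multivariateGaussian 0 (D.C t))) +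
            (DF y).smulRight (∫ ζ, D1 (y + ζ) ∂(multivariateGaussian 0 (D.C t)))))
          (EuclideanSpace.single i 1) (EuclideanSpace.single j 1) ∂(multivariateGaussian 0 (D.Cinf - D.C t)) := by
    rw [integral_finsetSum _ fun i _ => integrable_finsetSum _ fun j _ => hHKint i j]
    refine Finset.sum_congr rfl fun i _ => ?_
    rw [integral_finsetSum _ fun j _ => hHKint i j]
    refine Finset.sum_congr rfl fun j _ => ?_
    rw [integral_const_mul]
  have hSint : Integrable (fun y => ∑ i, ∑ j, D.Cdot t i j *
      ((∫ ζ, Real.exp (-V₀ (y + ζ)) ∂(multivariateGaussian 0 (D.C t))) • D2F y +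
          (∫ ζ, D1 (y + ζ) ∂(multivariateGaussian 0 (D.C t))).smulRight (DF y) +
        (F y • (∫ ζ, D2 (y + ζ) ∂(multivariateGaussian 0 (D.C t))) +
          (DF y).smulRight (∫ ζ, D1 (y + ζ) ∂(multivariateGaussian 0 (D.C t)))))
        (EuclideanSpace.single i 1) (EuclideanSpace.single j 1)) (multivariateGaussian 0 (D.Cinf - D.C t)) :=
    integrable_finsetSum _ fun i _ => integrable_finsetSum _ fun j _ => hHKint i j
  -- the pointwise identity `Z_t · L_tF = ½ Σ Ċ D²(Z_tF)_{ij} − Ż_t F`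
  have hpt : ∀ y : EuclideanSpace ℝ (Fin N),
      (∫ ζ, Real.exp (-V₀ (y + ζ)) ∂(multivariateGaussian 0 (D.C t))) *
        ((1 / 2) * ∑ i, ∑ j, D.Cdot t i j *
              D2F y (EuclideanSpace.single i 1) (EuclideanSpace.single j 1) -
            ∑ i, ∑ j, D.Cdot t i j *
              (-((∫ ζ, Real.exp (-V₀ (y + ζ)) ∂(multivariateGaussian 0 (D.C t)))⁻¹ •
                  ∫ ζ, D1 (y + ζ) ∂(multivariateGaussian 0 (D.C t)))) (EuclideanSpace.single i 1) *
                DF y (EuclideanSpace.single j 1)) =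
      (1 / 2) * (∑ i, ∑ j, D.Cdot t i j *
        ((∫ ζ, Real.exp (-V₀ (y + ζ)) ∂(multivariateGaussian 0 (D.C t))) • D2F y +
            (∫ ζ, D1 (y + ζ) ∂(multivariateGaussian 0 (D.C t))).smulRight (DF y) +
          (F y • (∫ ζ, D2 (y + ζ) ∂(multivariateGaussian 0 (D.C t))) +
            (DF y).smulRight (∫ ζ, D1 (y + ζ) ∂(multivariateGaussian 0 (D.C t)))))
          (EuclideanSpace.single i 1) (EuclideanSpace.single j 1)) -
        ((1 / 2) * ∑ i, ∑ j, D.Cdot t i j *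
          ∫ w, D2 (y + w) (EuclideanSpace.single i 1) (EuclideanSpace.single j 1)
            ∂(multivariateGaussian 0 (D.C t))) * F y := by
    intro y
    set Z : ℝ := ∫ ζ, Real.exp (-V₀ (y + ζ)) ∂(multivariateGaussian 0 (D.C t)) with hZdef
    set gZ : EuclideanSpace ℝ (Fin N) →L[ℝ] ℝ := ∫ ζ, D1 (y + ζ) ∂(multivariateGaussian 0 (D.C t))
      with hgZdef
    set HZ : EuclideanSpace ℝ (Fin N) →L[ℝ] EuclideanSpace ℝ (Fin N) →L[ℝ] ℝ :=
      ∫ ζ, D2 (y + ζ) ∂(multivariateGaussian 0 (D.C t)) with hHZdef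
    have hne : Z ≠ 0 := (hZpos y).ne'
    have hHZ' : ∀ i j, (∫ w, D2 (y + w) (EuclideanSpace.single i 1) (EuclideanSpace.single j 1)
        ∂(multivariateGaussian 0 (D.C t))) = HZ (EuclideanSpace.single i 1) (EuclideanSpace.single j 1) :=
      fun i j => (hHZij y i j).symm
    have hgV : ∀ i : Fin N, (-(Z⁻¹ • gZ)) (EuclideanSpace.single i 1) =
        -(Z⁻¹ * gZ (EuclideanSpace.single i 1)) := fun i => by
      simp only [_root_.neg_apply, _root_.smul_apply, smul_eq_mul]
    have hHKe : ∀ i j : Fin N, (Z • D2F y + gZ.smulRight (DF y) + (F y • HZ + (DF y).smulRight gZ))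
        (EuclideanSpace.single i 1) (EuclideanSpace.single j 1) =
        Z * D2F y (EuclideanSpace.single i 1) (EuclideanSpace.single j 1) +
          gZ (EuclideanSpace.single i 1) * DF y (EuclideanSpace.single j 1) +
          (F y * HZ (EuclideanSpace.single i 1) (EuclideanSpace.single j 1) +
            DF y (EuclideanSpace.single i 1) * gZ (EuclideanSpace.single j 1)) := fun i j => by
      simp only [_root_.add_apply, _root_.smul_apply, smul_eq_mul, ContinuousLinearMap.smulRight_apply]
    simp_rw [hHZ', hgV, hHKe]
    -- split the sums
    have hS1 : ∑ i, ∑ j, D.Cdot t i j * -(Z⁻¹ * gZ (EuclideanSpace.single i 1)) *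
        DF y (EuclideanSpace.single j 1) =
        -Z⁻¹ * ∑ i, ∑ j, D.Cdot t i j *
          (gZ (EuclideanSpace.single i 1) * DF y (EuclideanSpace.single j 1)) := by
      simp only [Finset.mul_sum]
      refine Finset.sum_congr rfl fun i _ => Finset.sum_congr rfl fun j _ => ?_
      ring
    have hS2 : ∑ i, ∑ j, D.Cdot t i j *
        (Z * D2F y (EuclideanSpace.single i 1) (EuclideanSpace.single j 1) +
          gZ (EuclideanSpace.single i 1) * DF y (EuclideanSpace.single j 1) +
          (F y * HZ (EuclideanSpace.single i 1) (EuclideanSpace.single j 1) +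
            DF y (EuclideanSpace.single i 1) * gZ (EuclideanSpace.single j 1))) =
        Z * (∑ i, ∑ j, D.Cdot t i j * D2F y (EuclideanSpace.single i 1) (EuclideanSpace.single j 1)) +
        (∑ i, ∑ j, D.Cdot t i j *
          (gZ (EuclideanSpace.single i 1) * DF y (EuclideanSpace.single j 1))) +
        F y * (∑ i, ∑ j, D.Cdot t i j * HZ (EuclideanSpace.single i 1) (EuclideanSpace.single j 1)) +
        (∑ i, ∑ j, D.Cdot t i j *
          (DF y (EuclideanSpace.single i 1) * gZ (EuclideanSpace.single j 1))) := by
      simp only [Finset.mul_sum, ← Finset.sum_add_distrib]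
      refine Finset.sum_congr rfl fun i _ => Finset.sum_congr rfl fun j _ => ?_
      ring
    have hsymm : ∑ i, ∑ j, D.Cdot t i j *
        (DF y (EuclideanSpace.single i 1) * gZ (EuclideanSpace.single j 1)) =
        ∑ i, ∑ j, D.Cdot t i j *
          (gZ (EuclideanSpace.single i 1) * DF y (EuclideanSpace.single j 1)) := by
      rw [Finset.sum_comm]
      refine Finset.sum_congr rfl fun j _ => Finset.sum_congr rfl fun i _ => ?_
      rw [D.Cdot_symm ht.le j i]
      ring
    rw [hS1, hS2, hsymm]
    field_simp
    ring
  -- assemble: both sides are integrals of the same function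
  rw [hswap]
  have hR : ∫ y, Real.exp (-renormPotential D V₀ t y) *
      ((1 / 2) * ∑ i, ∑ j, D.Cdot t i j *
            D2F y (EuclideanSpace.single i 1) (EuclideanSpace.single j 1) -
          ∑ i, ∑ j, D.Cdot t i j *
            (-((∫ ζ, Real.exp (-V₀ (y + ζ)) ∂(multivariateGaussian 0 (D.C t)))⁻¹ •
                ∫ ζ, D1 (y + ζ) ∂(multivariateGaussian 0 (D.C t)))) (EuclideanSpace.single i 1) *
              DF y (EuclideanSpace.single j 1)) ∂(multivariateGaussian 0 (D.Cinf - D.C t)) =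
      ∫ y, ((1 / 2) * (∑ i, ∑ j, D.Cdot t i j *
        ((∫ ζ, Real.exp (-V₀ (y + ζ)) ∂(multivariateGaussian 0 (D.C t))) • D2F y +
            (∫ ζ, D1 (y + ζ) ∂(multivariateGaussian 0 (D.C t))).smulRight (DF y) +
          (F y • (∫ ζ, D2 (y + ζ) ∂(multivariateGaussian 0 (D.C t))) +
            (DF y).smulRight (∫ ζ, D1 (y + ζ) ∂(multivariateGaussian 0 (D.C t)))))
          (EuclideanSpace.single i 1) (EuclideanSpace.single j 1)) -
        ((1 / 2) * ∑ i, ∑ j, D.Cdot t i j *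
          ∫ w, D2 (y + w) (EuclideanSpace.single i 1) (EuclideanSpace.single j 1)
            ∂(multivariateGaussian 0 (D.C t))) * F y) ∂(multivariateGaussian 0 (D.Cinf - D.C t)) := by
    refine integral_congr_ae (Eventually.of_forall fun y => ?_)
    show Real.exp (-renormPotential D V₀ t y) * _ = _
    rw [exp_neg_renormPotential D hV hb t y]
    exact hpt y
  rw [hR, integral_sub (hSint.const_mul _) hZdFint, integral_const_mul]
  ring

end Dual

end Polchinski

end Literature.Analysis.FunctionSpaces

end
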